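import Mathlib
import Summits.KontsevichZagierPeriods.Zeta5Search.Certificates.RayC1Thm1Shape
import HarnessLib

/-!
# The `∃ᶠ` C1 theorem read as an INFINITE SEQUENCE: strictly increasing indices, integer pairs `(p_k, q_k)`
(cert-1 g8, S4-C1 LITE — mechanical corollaries of `RayC1Thm1Shape` for the referees' faithfulness question (1); no new certificate)

HONEST FRAMING: systematic search; no irrationality claim unless certified.  C1 is the CALIBRATION ray
`a = (18,32,23,30,28,38,43,30)`; `(P_n, Q_n) = (c1P n, c1Q n)`.  The landed theorem `c1_theorem1_shape` (p330137) states its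
non-vanishing/metric clause with the filter quantifier `∃ᶠ n in atTop` ("for infinitely many `n`").  This file only UNFOLDS that
quantifier into the shape of the printed sentence of [BZ22, Thm 1] ("an infinite sequence of rational approximations `p/q`,
`p, q ∈ ℤ`, with `0 < |ζ(5) − p/q| < q^{−γ}`"), for the C1 pair and the R9 literal `γ = 4347/5000 = 0.8694`:

* `c1_intPair_frequently` — for every `0 ≤ γ ≤ 4347/5000` and infinitely many `n` there are INTEGERS `p` and `q ≥ 1` with
  `p/q = P_n/Q_n` and `0 < |ζ(5) − p/q| < 1/q^γ` (the (M)-clause's own integers `q = kMPR9 n·|Q_n|`, `p = ±kMPR9 n·P_n`,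
  from `RayC1.c1_exponent_classR9`, positivity from (N ∃ᶠ) `c1Form_frequently_ne_zero`);
* `c1_theorem1_intSequence` — `Filter.extraction_of_frequently_atTop` applied to it: a STRICTLY INCREASING index sequence
  `n_0 < n_1 < …` and integer pairs `(p_k, q_k)`, `q_k ≥ 1`, `p_k/q_k = P_{n_k}/Q_{n_k}`, with `0 < |ζ(5) − p_k/q_k| < 1/q_k^{0.8694}`
  for EVERY `k`, together with `p_k/q_k → ζ(5)` (from `tendsto_c1P_div_c1Q` along the subsequence);
* `c1_theorem1_shape_sequence` — the same extraction for the reduced-denominator clause of `c1_theorem1_shape` itself.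

WHAT THIS IS NOT: no new mathematics, no new number; NOT `theorem1'` (which is `∀ᶠ` and about BZ's own pair, #12); the pairs
`(p_k, q_k)` are terms (up to the sign of `Q_n` and the common multiplier) of ONE Apéry-type pair (`aperyType_c1PQ`), extracted along
a subsequence — whether that is a faithful reading of the printed "effective infinite sequence" is the referees' read, not this
file's.  Exponent `0.8694 < 1`: NO irrationality content; no number in print moves; C1 stays a calibration ray.
-/

namespace Summit.KontsevichZagierPeriods.Zeta5Search.RayC1.Generic

open Filter Topology
open Literature.NumberTheory.Transcendental (zetaValue)

/-- **(N ∃ᶠ) ⊕ (M)-R9 with the (M)-clause's own INTEGERS.**  For every `0 ≤ γ ≤ 4347/5000` and infinitely many `n` there are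
`p ∈ ℤ`, `q ∈ ℕ`, `q ≥ 1`, with `p/q = P_n/Q_n` (namely `q = kMPR9 n·|Q_n|`, `p = sgn(Q_n)·kMPR9 n·P_n`) and
`0 < |ζ(5) − p/q| < 1/q^γ`.  HONEST FRAMING: `γ < 1`; no irrationality content; C1 = calibration ray. -/
theorem c1_intPair_frequently {γ : ℝ} (h0 : 0 ≤ γ) (hγ : γ ≤ 4347 / 5000) :
    ∃ᶠ n : ℕ in atTop, ∃ p : ℤ, ∃ q : ℕ, 1 ≤ q ∧ (p : ℚ) / q = c1P n / (c1Q n : ℚ) ∧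
      0 < |zetaValue 5 - (p : ℝ) / q| ∧ |zetaValue 5 - (p : ℝ) / q| < 1 / (q : ℝ) ^ γ := by
  refine (c1Form_frequently_ne_zero.and_eventually
    ((eventually_ge_atTop 1).and (c1_exponent_classR9 h0 hγ))).mono fun n hn => ?_
  obtain ⟨hL, hn1, p, q, hq, hqQ, hpP, hlt⟩ := hn
  have hQQ : (c1Q n : ℚ) ≠ 0 := by exact_mod_cast c1Q_ne_zero n
  have hQR : (c1Q n : ℝ) ≠ 0 := by exact_mod_cast c1Q_ne_zero n
  have hq0 : (q : ℚ) ≠ 0 := by exact_mod_cast (by omega : q ≠ 0)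
  -- the signed numerator `p' = sgn(Q_n)·p` represents `P_n/Q_n` exactly over the denominator `q`
  obtain ⟨p', hp'⟩ : ∃ p' : ℤ, (p' : ℚ) / q = c1P n / (c1Q n : ℚ) := by
    rcases abs_choice ((c1Q n : ℚ)) with habs | habs
    · exact ⟨p, by rw [div_eq_div_iff hq0 hQQ, hpP, hqQ, habs]; ring⟩
    · exact ⟨-p, by rw [Int.cast_neg, div_eq_div_iff hq0 hQQ, hpP, hqQ, habs]; ring⟩
  have hcast : (p' : ℝ) / q = (c1P n : ℝ) / (c1Q n : ℝ) := by
    have h := congrArg (fun x : ℚ => (x : ℝ)) hp'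
    simpa using h
  refine ⟨p', q, hq, hp', ?_, ?_⟩
  · rw [hcast, c1P_div_c1Q_eq hn1, sub_sub_cancel, abs_pos]
    exact div_ne_zero hL hQR
  · rw [hcast]
    exact hlt

/-- **The printed sentence's shape, literally, for the C1 pair at `γ = 0.8694`: an infinite SEQUENCE.**  There are a strictly
increasing `φ : ℕ → ℕ` (indices `n_k = φ k`) and, for every `k`, integers `p_k` and `q_k ≥ 1` with `p_k/q_k = P_{n_k}/Q_{n_k}`,
`0 < |ζ(5) − p_k/q_k| < 1/q_k^{4347/5000}`; moreover `P_{n_k}/Q_{n_k} → ζ(5)`.  Obtained from `c1_intPair_frequently` by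
`Filter.extraction_of_frequently_atTop` and from `tendsto_c1P_div_c1Q` along `φ`.  HONEST FRAMING: `0.8694 < 1`; no irrationality
content; the `(p_k, q_k)` are (rescaled, sign-adjusted) terms of ONE Apéry-type pair along a subsequence — faithfulness to the
printed "effective" is the referees' read; NOT `theorem1'`; C1 = calibration ray. -/
theorem c1_theorem1_intSequence :
    ∃ φ : ℕ → ℕ, StrictMono φ ∧
      Tendsto (fun k => ((c1P (φ k) / (c1Q (φ k) : ℚ) : ℚ) : ℝ)) atTop (𝓝 (zetaValue 5)) ∧
      ∀ k, ∃ p : ℤ, ∃ q : ℕ, 1 ≤ q ∧ (p : ℚ) / q = c1P (φ k) / (c1Q (φ k) : ℚ) ∧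
        0 < |zetaValue 5 - (p : ℝ) / q| ∧ |zetaValue 5 - (p : ℝ) / q| < 1 / (q : ℝ) ^ (4347 / 5000 : ℝ) := by
  obtain ⟨φ, hφ, hall⟩ := extraction_of_frequently_atTop (c1_intPair_frequently (γ := 4347 / 5000) (by norm_num) le_rfl)
  exact ⟨φ, hφ, tendsto_c1P_div_c1Q.comp hφ.tendsto_atTop, hall⟩

/-- **The reduced-denominator clause of `c1_theorem1_shape` as an infinite sequence.**  A strictly increasing `φ` with, for every
`k`: `Q_{n_k} ≠ 0`, `0 < |ζ(5) − P_{n_k}/Q_{n_k}| < 1/den(P_{n_k}/Q_{n_k})^{4347/5000}`, and `P_{n_k}/Q_{n_k} → ζ(5)`.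
HONEST FRAMING: `0.8694 < 1`; no irrationality content; NOT `theorem1'`; C1 = calibration ray. -/
theorem c1_theorem1_shape_sequence :
    ∃ φ : ℕ → ℕ, StrictMono φ ∧
      Tendsto (fun k => ((c1P (φ k) / (c1Q (φ k) : ℚ) : ℚ) : ℝ)) atTop (𝓝 (zetaValue 5)) ∧
      ∀ k, (c1Q (φ k) : ℚ) ≠ 0 ∧ 0 < |zetaValue 5 - ((c1P (φ k) / (c1Q (φ k) : ℚ) : ℚ) : ℝ)| ∧
        |zetaValue 5 - ((c1P (φ k) / (c1Q (φ k) : ℚ) : ℚ) : ℝ)| <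
          1 / ((c1P (φ k) / (c1Q (φ k) : ℚ)).den : ℝ) ^ (4347 / 5000 : ℝ) := by
  obtain ⟨φ, hφ, hall⟩ :=
    extraction_of_frequently_atTop (c1_shape_clauses_frequently (γ := 4347 / 5000) (by norm_num) le_rfl)
  exact ⟨φ, hφ, tendsto_c1P_div_c1Q.comp hφ.tendsto_atTop, hall⟩

end Summit.KontsevichZagierPeriods.Zeta5Search.RayC1.Generic
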